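import Summits.QuantumFields.YangMills.Theorems.BalabanUVNodesN08HaarCompatibilityGuardOneStepBound

/-!
# BalabanUVNodes ∕ N08 — THE LATTICE-FREE CORE OF THE GUARDED FIBRE MAP: (H_K) reduces to a statement about ONE explicit self-map of the group
# parametrised by finitely many group elements — `w ↦ [ℰ-average of (V_i·w⁻¹)_i, or 1 off the guard]·w` — because every loop of (0.4) at `c` carries
# the private coordinate `β(c)` exactly once, through the axis `U(c) = pre·U(β(c))·post`

WIDTH SEAT `pub-ymgap-dag-n08-w3` g4, `W-SEAT-START-LIST.md` v10 §0 (iii); item-3 lineage part 24, 2026-08-28.  DAG node N08 = [Balaban1985UV3] Thm 1 p. 257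
(compact) + Thm 2 p. 272; the typed (0.4) averaging and its guard = [Balaban1987RG1] (0.4) p. 253; key item K1⁷ `StabilityBAtRecordR13SepCoPH`
(stmt-QuantumFields-20542), `--supports … --as helper`.  COUNT-NEUTRAL.

THE POINT.  Part 20's hypothesis (H_K) speaks of the fibre maps `ψ_{U,c} : g ↦ Ū(c)(U[β(c) ↦ g])` for EVERY background `U` of the fine lattice.  pub-balaban's
normal form of the loop variables (`BlockAveragingHaarAC`: `loopHol = openHol · U(c)⁻¹`, `openHol` does not see `β(c)` at non-central indices and equals
`U(c)` at central ones, `U(c)(U[β(c) ↦ g]) = pre·g·post`) makes `ψ_{U,c}` an EXPLICIT function of the two-sided translate `w = pre·g·post`: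
 §1 `loopHol_update_centralBond_eq`: the loop family on the fibre is `i ↦ (1 if i central, else V_i·w⁻¹)`, `V_i = openHol U c i`;
 §2 `avgFun_update_centralBond_eq`: `ψ_{U,c}(g) = Φ_V(pre·g·post)` with the LATTICE-FREE CORE
      `Φ_V(w) = (if ∀ i, dist1(F_V(w)_i) < δ then ℰ.avg F_V(w) else 1)·w`,  `F_V(w)_i = (1 | V_i·w⁻¹)`,
    a self-map of `G` parametrised by the finite family `V : Idx → G` (and the set of central indices, which depends on `c.dir` only);
 §3 `map_haar_fibre_eq_map_core`: `Haar ∘ ψ_{U,c}⁻¹ = Haar ∘ Φ_V⁻¹` (`g ↦ pre·g·post` preserves Haar), and the guard-admitting condition transfers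
    (`exists_small_update_iff`);
 §4 ★ `smul_map_avgFun_le_of_core`: hence part 20's one-step bound holds under the LATTICE-FREE hypothesis
      (H_K-core)  for every coarse bond direction's central set and every family `V : Idx → G` whose core map meets the guard, `Haar ∘ Φ_V⁻¹ ≤ K·Haar`,
    and the [B10]-slot reading `smul_map_avOfPrint_le_of_core`.  Off the guard `Φ_V` IS the identity — exactly the `τ = id` case of part 21's frame
    `haar_map_le_of_windows`; for the printed exp-mean-log `ℰ`, `Φ_V(w) = exp(Σᵢ cᵢ log(Vᵢ w*))·w` on the guard is pub-balaban's `Kmat V c w`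
    (`T4EMLTangentInjective`; differentiable with differential `emlD`, floors: part 14 ∕ n08-w6) — so (E3a) of the engine is «in the tree» up to this dictionary.

HONEST FRAMING.  [folklore] bookkeeping over pub-balaban's normal form; nothing of Bałaban's asserted; (H_K) ∕ (H_K-core) NOT discharged; E6′ NOT decided; `hmass` NOT
supplied; count-neutral; N08 NOT discharged; counts unmoved (typed 28∕28 · discharged 5∕27); one finite 𝕋⁴ programme at fixed ε — R4 closes the CONDITIONAL rung
`BalabanLadder.UV` only; the Yang–Mills mass gap (Clay) is NOT proved; nothing continuum ∕ OS.  0 `sorry`, 0 `def`, standard axioms.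
-/

noncomputable section

open MeasureTheory Function
open scoped ENNReal

namespace Summit.QuantumFields.YangMills.BalabanUVNodes.N08HaarCompatibilityGuardFibreCore

open Literature.MathematicalPhysics.QuantumFieldTheory.Balaban1983to89
open Literature.MathematicalPhysics.QuantumFieldTheory.Balaban1983to89.AveragingRT (axialAvg)
open Literature.MathematicalPhysics.QuantumFieldTheory.Balaban1983to89.BlockAveraging (Idx off loopHol Small corr avgFun)
open Literature.MathematicalPhysics.QuantumFieldTheory.Balaban1983to89.BlockAveragingHaarAC
  (IsCentral centralBond pre post openHol openHol_of_isCentral openHol_update_of_not_isCentral loopHol_eq_openHol_mul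
    axialAvg_update_centralBond)
open Summit.QuantumFields.YangMills.BalabanUVNodes.N08HaarCompatibilityGuardOneStepBound (smul_map_avgFun_le)

variable {P : Params} {j : ℕ} {G : Type*} [GaugeGroup G] (ℰ : LoopAverage G)

/-! ## §1 The loop family on the fibre -/

omit ℰ in
/-- **THE LOOP VARIABLES ON THE `β(c)`-FIBRE**: at `U[β(c) ↦ g]`, the loop variable of (0.4) at `c` with index `i` is `1` if `i` is central and
`V_i · (pre·g·post)⁻¹` otherwise, `V_i = openHol U c i` (independent of `g`). [cite: Balaban1987RG1, (0.4) p.253 (bookkeeping over pub-balaban's normal form)] -/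
theorem loopHol_update_centralBond_eq (hj : j + 1 ≤ P.m + P.K) (U : GaugeField P j G) (c : PBond P (j + 1)) (i : Idx P) (g : G) :
    loopHol (update U (centralBond c) g) c i = if IsCentral c i then (1 : G) else openHol U c i * (pre U c * g * post U c)⁻¹ := by
  classical
  rw [loopHol_eq_openHol_mul, axialAvg_update_centralBond hj]
  split_ifs with h
  · rw [openHol_of_isCentral _ _ _ h, axialAvg_update_centralBond hj, mul_inv_cancel]
  · rw [openHol_update_of_not_isCentral hj U c i h g]

/-- As a family: `loopHol (U[β(c) ↦ g]) c = F_V(pre·g·post)`. [cite: Balaban1987RG1, (0.4) p.253 (bookkeeping)] -/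
theorem loopHol_update_centralBond_eq_fun (hj : j + 1 ≤ P.m + P.K) (U : GaugeField P j G) (c : PBond P (j + 1)) (g : G) :
    loopHol (update U (centralBond c) g) c = fun i => if IsCentral c i then (1 : G) else openHol U c i * (pre U c * g * post U c)⁻¹ :=
  funext fun i => loopHol_update_centralBond_eq hj U c i g

/-! ## §2 The fibre map is the lattice-free core at `w = pre·g·post` -/

/-- ★ **THE FIBRE MAP IS THE CORE MAP AT THE TRANSLATE**: `Ū(c)(U[β(c) ↦ g]) = Φ_V(pre·g·post)`,
`Φ_V(w) = (if ∀ i, dist1(F_V(w)_i) < δ then ℰ.avg F_V(w) else 1)·w`, `F_V(w)_i = (1 | V_i·w⁻¹)`, `V = openHol U c`.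
[cite: Balaban1987RG1, (0.4) p.253 (the typed averaging; bookkeeping)] -/
theorem avgFun_update_centralBond_eq (hj : j + 1 ≤ P.m + P.K) (U : GaugeField P j G) (c : PBond P (j + 1)) (g : G) :
    avgFun ℰ (update U (centralBond c) g) c =
      (if ∀ i : Idx P, dist1 (if IsCentral c i then (1 : G) else openHol U c i * (pre U c * g * post U c)⁻¹) < ℰ.δ then
          ℰ.avg (fun i : Idx P => if IsCentral c i then (1 : G) else openHol U c i * (pre U c * g * post U c)⁻¹)
        else 1) * (pre U c * g * post U c) := by
  classical
  show corr ℰ (update U (centralBond c) g) c * axialAvg (update U (centralBond c) g) c = _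
  unfold corr BlockAveraging.Small
  rw [loopHol_update_centralBond_eq_fun hj, axialAvg_update_centralBond hj]
  congr 1
  exact ite_congr rfl (fun _ => rfl) (fun _ => rfl)

/-- The guard on the fibre in core terms: `Small ℰ (U[β(c) ↦ g]) c ↔ ∀ i, dist1(F_V(pre·g·post)_i) < δ`. [cite: Balaban1987RG1, (0.4) p.253 (bookkeeping)] -/
theorem small_update_centralBond_iff (hj : j + 1 ≤ P.m + P.K) (U : GaugeField P j G) (c : PBond P (j + 1)) (g : G) :
    Small ℰ (update U (centralBond c) g) c ↔
      ∀ i : Idx P, dist1 (if IsCentral c i then (1 : G) else openHol U c i * (pre U c * g * post U c)⁻¹) < ℰ.δ := by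
  unfold BlockAveraging.Small
  rw [loopHol_update_centralBond_eq_fun hj]

/-- `g ↦ pre·g·post` is a bijection of `G`; in particular the guard-admitting condition transfers:
`(∃ g, Small ℰ (U[β(c) ↦ g]) c) ↔ (∃ w, ∀ i, dist1(F_V(w)_i) < δ)`. [cite: Balaban1987RG1, (0.4) p.253 (bookkeeping)] -/
theorem exists_small_update_iff (hj : j + 1 ≤ P.m + P.K) (U : GaugeField P j G) (c : PBond P (j + 1)) :
    (∃ g : G, Small ℰ (update U (centralBond c) g) c) ↔
      ∃ w : G, ∀ i : Idx P, dist1 (if IsCentral c i then (1 : G) else openHol U c i * w⁻¹) < ℰ.δ := by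
  constructor
  · rintro ⟨g, hg⟩
    exact ⟨pre U c * g * post U c, (small_update_centralBond_iff ℰ hj U c g).1 hg⟩
  · rintro ⟨w, hw⟩
    refine ⟨(pre U c)⁻¹ * w * (post U c)⁻¹, (small_update_centralBond_iff ℰ hj U c _).2 ?_⟩
    have : pre U c * ((pre U c)⁻¹ * w * (post U c)⁻¹) * post U c = w := by group
    rw [this]
    exact hw

/-! ## §3 The fibre law is the law of the core map -/

section Law

variable [MeasurableSpace G] [RegularGaugeGroup G] [HaarData G]

omit [HaarData G] in
/-- The core map is measurable (given a measurable small-loop average `E`). [folklore] -/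
theorem measurable_core (hE : ∀ n, Measurable fun W : Fin (n + 1) → G => ℰ.E W) (c : PBond P (j + 1)) (V : Idx P → G) :
    Measurable fun w : G =>
      (if ∀ i : Idx P, dist1 (if IsCentral c i then (1 : G) else V i * w⁻¹) < ℰ.δ then
          ℰ.avg (fun i : Idx P => if IsCentral c i then (1 : G) else V i * w⁻¹) else 1) * w := by
  have hF : Measurable fun w : G => fun i : Idx P => if IsCentral c i then (1 : G) else V i * w⁻¹ := by
    refine measurable_pi_lambda _ fun i => ?_
    by_cases h : IsCentral c i
    · simp only [if_pos h]; exact measurable_const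
    · simp only [if_neg h]; exact (measurable_const_mul (V i)).comp measurable_inv
  have hS : MeasurableSet {w : G | ∀ i : Idx P, dist1 (if IsCentral c i then (1 : G) else V i * w⁻¹) < ℰ.δ} := by
    have : {w : G | ∀ i : Idx P, dist1 (if IsCentral c i then (1 : G) else V i * w⁻¹) < ℰ.δ} =
        ⋂ i : Idx P, {w : G | dist1 (if IsCentral c i then (1 : G) else V i * w⁻¹) < ℰ.δ} := by
      ext w; simp
    rw [this]
    exact MeasurableSet.iInter fun i =>
      measurableSet_lt (RegularGaugeGroup.measurable_dist1.comp ((measurable_pi_apply i).comp hF)) measurable_const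
  exact (Measurable.ite hS ((ℰ.measurable_avg hE).comp hF) measurable_const).mul measurable_id

/-- ★ **THE FIBRE LAW IS THE LAW OF THE CORE MAP**: `Haar ∘ ψ_{U,c}⁻¹ = Haar ∘ Φ_V⁻¹` with `V = openHol U c` (the translate `g ↦ pre·g·post` preserves Haar).
[cite: Balaban1987RG1, (0.4) p.253 (bookkeeping)] -/
theorem map_haar_fibre_eq_map_core (hj : j + 1 ≤ P.m + P.K) (hE : ∀ n, Measurable fun W : Fin (n + 1) → G => ℰ.E W)
    (U : GaugeField P j G) (c : PBond P (j + 1)) :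
    (HaarData.haar : Measure G).map (fun g => avgFun ℰ (update U (centralBond c) g) c) =
      (HaarData.haar : Measure G).map (fun w : G =>
        (if ∀ i : Idx P, dist1 (if IsCentral c i then (1 : G) else openHol U c i * w⁻¹) < ℰ.δ then
            ℰ.avg (fun i : Idx P => if IsCentral c i then (1 : G) else openHol U c i * w⁻¹) else 1) * w) := by
  have hfun : (fun g => avgFun ℰ (update U (centralBond c) g) c) =
      ((fun w : G => (if ∀ i : Idx P, dist1 (if IsCentral c i then (1 : G) else openHol U c i * w⁻¹) < ℰ.δ then
            ℰ.avg (fun i : Idx P => if IsCentral c i then (1 : G) else openHol U c i * w⁻¹) else 1) * w) ∘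
        (fun g => g * post U c)) ∘ (fun g => pre U c * g) := by
    funext g
    simp only [comp_apply]
    exact avgFun_update_centralBond_eq ℰ hj U c g
  rw [hfun, ← Measure.map_map ((measurable_core ℰ hE c _).comp (measurable_mul_const _)) (measurable_const_mul _),
    HaarData.map_mul_left, ← Measure.map_map (measurable_core ℰ hE c _) (measurable_mul_const _), HaarData.map_mul_right]

/-- **(H_K-core) ⇒ (H_K)**: if for every coarse bond `c` (through its central set only) and every finite family `V : Idx → G` whose core map meets the guard
the core law is `≤ K·Haar`, then every guard-admitting fibre law of the typed averaging is `≤ K·Haar` — part 20's hypothesis, for EVERY background `U`.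
[cite: Balaban1987RG1, (0.4) p.253 (bookkeeping)] -/
theorem fibre_law_le_of_core (hj : j + 1 ≤ P.m + P.K) (hE : ∀ n, Measurable fun W : Fin (n + 1) → G => ℰ.E W) {K : ℝ≥0∞}
    (hKc : ∀ (c : PBond P (j + 1)) (V : Idx P → G),
      (∃ w : G, ∀ i : Idx P, dist1 (if IsCentral c i then (1 : G) else V i * w⁻¹) < ℰ.δ) →
        (HaarData.haar : Measure G).map (fun w : G =>
          (if ∀ i : Idx P, dist1 (if IsCentral c i then (1 : G) else V i * w⁻¹) < ℰ.δ then
              ℰ.avg (fun i : Idx P => if IsCentral c i then (1 : G) else V i * w⁻¹) else 1) * w) ≤ K • (HaarData.haar : Measure G)) :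
    ∀ (c : PBond P (j + 1)) (U : GaugeField P j G), (∃ g : G, Small ℰ (update U (centralBond c) g) c) →
      (HaarData.haar : Measure G).map (fun g => avgFun ℰ (update U (centralBond c) g) c) ≤ K • (HaarData.haar : Measure G) := by
  intro c U hU
  rw [map_haar_fibre_eq_map_core ℰ hj hE U c]
  exact hKc c (openHol U c) ((exists_small_update_iff ℰ hj U c).1 hU)

/-! ## §4 Part 20's one-step bound under the lattice-free hypothesis -/

/-- ★★ **THE ONE-STEP EXTENSIVE TRANSPORT BOUND MODULO (H_K-core)**: for every small-loop average `ℰ` with measurable `E`, every `δ′`, and `K ∈ [1, ∞)` dominating the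
CORE laws, `h(δ′)^{n} • Ū_*(dU) ≤ (h(δ′) + (K − 1)·h(δ + δ′)^{L^{d−1}−1})^{n} • dV`, `n = #PBond(j+1)` (part 20 `smul_map_avgFun_le` + §3).
[cite: Balaban1987RG1, (0.4) p.253 (the typed averaging; bookkeeping — the bound is NOT in print)] -/
theorem smul_map_avgFun_le_of_core (hj : j + 1 ≤ P.m + P.K) (hE : ∀ n, Measurable fun W : Fin (n + 1) → G => ℰ.E W) {K : ℝ≥0∞}
    (hK1 : 1 ≤ K) (hKtop : K ≠ ∞)
    (hKc : ∀ (c : PBond P (j + 1)) (V : Idx P → G),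
      (∃ w : G, ∀ i : Idx P, dist1 (if IsCentral c i then (1 : G) else V i * w⁻¹) < ℰ.δ) →
        (HaarData.haar : Measure G).map (fun w : G =>
          (if ∀ i : Idx P, dist1 (if IsCentral c i then (1 : G) else V i * w⁻¹) < ℰ.δ then
              ℰ.avg (fun i : Idx P => if IsCentral c i then (1 : G) else V i * w⁻¹) else 1) * w) ≤ K • (HaarData.haar : Measure G))
    (δ' : ℝ) :
    (HaarData.haar : Measure G) {g : G | dist1 g < δ'} ^ Fintype.card (PBond P (j + 1)) • (fieldMeasure P j G).map (avgFun ℰ) ≤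
      ((HaarData.haar : Measure G) {g : G | dist1 g < δ'} +
          (K - 1) * (HaarData.haar : Measure G) {g : G | dist1 g < ℰ.δ + δ'} ^ (P.L ^ (P.d - 1) - 1)) ^ Fintype.card (PBond P (j + 1)) •
        fieldMeasure P (j + 1) G :=
  smul_map_avgFun_le ℰ hj hE hK1 hKtop (fibre_law_le_of_core ℰ hj hE hKc) δ'

end Law

/-! ## §5 At the [B10] slot's averaging `avOfPrint N S j` on `SU(N)` -/

section Slot

open Literature.MathematicalPhysics.QuantumFieldTheory.Balaban1985CMP102.Setting (Scales)
open Literature.MathematicalPhysics.QuantumFieldTheory.Balaban1983to89.B10RunsOfRecord (avOfPrint)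
open Literature.MathematicalPhysics.QuantumFieldTheory.Balaban1983to89.ExpMeanLog (expMeanLogSU expMeanLogSU_δ measurable_expMeanLogSU_E)
open Literature.MathematicalPhysics.QuantumFieldTheory.Balaban1983to89.Node00 (SU)
open Summit.QuantumFields.YangMills.BalabanUVNodes.N08HaarCompatibilityGuard (avOfPrint_avg_of_le)

variable (N : ℕ) [NeZero N] {L : ℕ}

/-- ★★ **AT THE SLOT, MODULO (H_K-core) FOR THE PRINTED exp-mean-log**: `h(δ′)^{n} • (avOfPrint)_*(dU) ≤ (h(δ′) + (K−1)·h(δ_N + δ′)^{L^{d−1}−1})^{n} • dV`,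
`n = #PBond(j+1)`, `δ_N = min(1∕3, π∕N)`, under the LATTICE-FREE hypothesis on the core maps `w ↦ [expMeanLogSU-average of (1 | V_i w⁻¹)]·w` on `SU(N)`.
[cite: Balaban1985UV3, (2) p.256; Balaban1987RG1, (0.4) p.253 (bookkeeping — the bound is NOT in print)] -/
theorem smul_map_avOfPrint_le_of_core (S₀ : Scales L) {j : ℕ} (hj : j + 1 ≤ S₀.P.m + S₀.P.K) {K : ℝ≥0∞} (hK1 : 1 ≤ K) (hKtop : K ≠ ∞)
    (hKc : ∀ (c : PBond S₀.P (j + 1)) (V : Idx S₀.P → SU N),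
      (∃ w : SU N, ∀ i : Idx S₀.P, dist1 (if IsCentral c i then (1 : SU N) else V i * w⁻¹) < (expMeanLogSU : LoopAverage (SU N)).δ) →
        (HaarData.haar : Measure (SU N)).map (fun w : SU N =>
          (if ∀ i : Idx S₀.P, dist1 (if IsCentral c i then (1 : SU N) else V i * w⁻¹) < (expMeanLogSU : LoopAverage (SU N)).δ then
              (expMeanLogSU : LoopAverage (SU N)).avg (fun i : Idx S₀.P => if IsCentral c i then (1 : SU N) else V i * w⁻¹) else 1) * w) ≤
          K • (HaarData.haar : Measure (SU N)))
    (δ' : ℝ) :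
    (HaarData.haar : Measure (SU N)) {g : SU N | dist1 g < δ'} ^ Fintype.card (PBond S₀.P (j + 1)) • (fieldMeasure S₀.P j (SU N)).map (avOfPrint N S₀ j).avg ≤
      ((HaarData.haar : Measure (SU N)) {g : SU N | dist1 g < δ'} +
          (K - 1) * (HaarData.haar : Measure (SU N)) {g : SU N | dist1 g < min (1 / 3) (Real.pi / N) + δ'} ^ (S₀.P.L ^ (S₀.P.d - 1) - 1)) ^
            Fintype.card (PBond S₀.P (j + 1)) •
        fieldMeasure S₀.P (j + 1) (SU N) := by
  have h := smul_map_avgFun_le_of_core (expMeanLogSU : LoopAverage (SU N)) hj measurable_expMeanLogSU_E hK1 hKtop hKc δ'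
  rw [expMeanLogSU_δ, Fintype.card_fin] at h
  rwa [avOfPrint_avg_of_le N S₀ hj]

end Slot

end Summit.QuantumFields.YangMills.BalabanUVNodes.N08HaarCompatibilityGuardFibreCore

end
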